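import Literature.Topology.FourManifolds.DeepArcPlanar
import Literature.Topology.FourManifolds.ChordPiece
import HarnessLib

/-!
# The deep closing arc: the chord spliced into the band image of the planar track

Topic `Literature/Topology/FourManifolds` (trunk T-4MAN). Fact seat
`provefact-Literature.Topology.FourManifolds.Knot.IsConnectedSum.isIsotopic` (Schubert's theorem),
geometric heart for rail knots, deep-chord design. For a datum `b` in normal position at the neck
scale `κ` the **deep arc** (family parameter `u ∈ [0, 1]`, loop parameter `t` between the two
cores) is, read in the chart,

* `chordPiece κ u (αLo t)` while `t ≤ parLo (7/2)` (the lower flat neck with the chart-straight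
  chord of `ChordPiece.lean` spliced in at `αLo ∈ [3/2, 5/2]` with weight `u`),
* `Fband (κ • deepTrack t)` after (the band image of the turn–tip–turn track of
  `DeepArcPlanar.lean`),

the two formulas agreeing for `αLo t ∈ [11/4, 15/4]` (`arcChart_eq_chordPiece_turnX`,
`arcChart_eq_band`). Results: joint smoothness (`contDiffAt_arcChart`); at `u = 0` the arc is the
band image of the planar track (`arcChart_zero`); off the chord window nothing depends on `u`
(`arcChart_eq_arcChart_zero`); at `u = 1` on the window the arc is the straight chord line
(`arcChart_one_of_mem`); the arc is **exactly south** between the centres of the cores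
(`norm_arcChart_lt_two`); its blow-up coordinates are controlled (`blowUp_arcChart_zero_ge`:
first coordinate `≥ v - 8ε` on `[parLo v, parHi v]`; `norm_blowUp_arcChart_le`;
`norm_arcChart_sub_pZero_le`); it is regular (`deriv_arcChart_ne_zero`) and injective
(`injOn_arcChart`) on `[parLo (-3), parHi (-3)]`; and read back on the sphere (`arcPiece`) it is a
`C^∞` unit regular injective piece.

Everything is proved; no named facts are introduced.

## References

Standard; all statements `[folklore]`.
-/

open scoped Manifold ContDiff Topology Real
open Function Set Metric Filter

noncomputable section

namespace Literature.Topology.FourManifolds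

/-- Local notation: `𝔼 n` is the model Euclidean space `EuclideanSpace ℝ (Fin n)`. -/
local notation "𝔼 " n:arg => EuclideanSpace ℝ (Fin n)

/-- Local notation: `𝕊 n` is the unit sphere in `EuclideanSpace ℝ (Fin (n + 1))`. -/
local notation "𝕊 " n:arg => (Metric.sphere (0 : EuclideanSpace ℝ (Fin (n + 1))) 1)

attribute [local instance] fact_finrank_euclideanSpace_succ

open KnotsInBall

namespace BandData

variable {A B K : Knot} {avoid : Set (𝕊 3)} (b : BandData A B K avoid)
  (hcross : b.band ⁻¹' sphereEquator 2 ∩ squareNhd b.δ = {x ∈ squareNhd b.δ | x 0 = 2⁻¹})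
  {κ : ℝ} (hκ : 0 < κ) (h7 : 7 * κ ≤ b.gapLo) (h7' : 7 * κ ≤ b.gapHi)

/-! ### Levels -/

omit b in
/-- `7/2 ∈ [-7, 7]`. [folklore] -/
theorem seven_halves_mem : (7 / 2 : ℝ) ∈ Icc (-7 : ℝ) 7 := ⟨by norm_num, by norm_num⟩

omit b in
/-- `11/4 ∈ [-7, 7]`. [folklore] -/
theorem eleven_quarters_mem : (11 / 4 : ℝ) ∈ Icc (-7 : ℝ) 7 := ⟨by norm_num, by norm_num⟩

omit b in
/-- `15/4 ∈ [-7, 7]`. [folklore] -/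
theorem fifteen_quarters_mem : (15 / 4 : ℝ) ∈ Icc (-7 : ℝ) 7 := ⟨by norm_num, by norm_num⟩

omit b in
/-- `-3 ∈ [-7, 7]`. [folklore] -/
theorem neg_three_mem : (-3 : ℝ) ∈ Icc (-7 : ℝ) 7 := ⟨by norm_num, by norm_num⟩

/-! ### The deep arc read in the chart -/

/-- **The deep arc in the chart**: the chord piece of the lower neck up to `parLo (7/2)`, the band
image of the planar track after. [folklore] -/
def arcChart (u t : ℝ) : 𝔼 3 :=
  if t ≤ b.parLo hκ h7 seven_halves_mem then b.chordPiece κ u (b.alphaLo κ t)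
  else b.Fband (κ • b.deepTrack hκ h7 h7' t)

/-- Left of `parLo (7/2)` the arc is the chord piece. [folklore] -/
theorem arcChart_of_le {u t : ℝ} (ht : t ≤ b.parLo hκ h7 seven_halves_mem) :
    b.arcChart hκ h7 h7' u t = b.chordPiece κ u (b.alphaLo κ t) := by simp [arcChart, ht]

/-- Right of `parLo (7/2)` the arc is the band image of the track. [folklore] -/
theorem arcChart_of_gt {u t : ℝ} (ht : b.parLo hκ h7 seven_halves_mem < t) :
    b.arcChart hκ h7 h7' u t = b.Fband (κ • b.deepTrack hκ h7 h7' t) := by simp [arcChart, not_le.2 ht]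

/-- The rail at the neck line is the band image of the model neck point. [folklore] -/
theorem railLoPsi_eq_Fband_smul (κ α : ℝ) : b.railLoPsi κ α = b.Fband (κ • pt2 α (-1)) := by
  rw [railLoPsi]; congr 1; ext i; fin_cases i <;> simp

/-- The upper rail at the neck line is the band image of the model neck point. [folklore] -/
theorem railHiPsi_eq_Fband_smul (κ α : ℝ) : b.railHiPsi κ α = b.Fband (κ • pt2 α 1) := by
  rw [railHiPsi]; congr 1; ext i; fin_cases i <;> simp

/-- **On `[parLo (11/4), parHi (-7)]` the arc is the band image of the track** (every `u`).
[folklore] -/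
theorem arcChart_eq_band {u t : ℝ} (ht : t ∈ Icc (b.parLo hκ h7 eleven_quarters_mem) (b.parHi hκ h7' neg_seven_mem)) :
    b.arcChart hκ h7 h7' u t = b.Fband (κ • b.deepTrack hκ h7 h7' t) := by
  rcases le_or_gt t (b.parLo hκ h7 seven_halves_mem) with h | h
  · rw [b.arcChart_of_le hκ h7 h7' h]
    have hc : t ∈ Icc (b.tcLo - b.epsLo / 8) (b.tcLo + b.epsLo / 8) :=
      ⟨le_trans (b.parLo_mem_core hκ h7 eleven_quarters_mem).1 ht.1, le_trans h (b.parLo_mem_core hκ h7 seven_halves_mem).2⟩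
    have h1 : 11 / 4 ≤ b.alphaLo κ t := (b.le_alphaLo_iff' hκ h7 eleven_quarters_mem hc).2 ht.1
    have h2 : b.alphaLo κ t ≤ 7 / 2 := (b.alphaLo_le_iff' hκ h7 seven_halves_mem hc).2 h
    rw [b.chordPiece_eq_rail (fun hm ↦ by linarith [hm.2]), b.deepTrack_of_alphaLo_le hκ h7 h7' hc h2,
      b.railLoPsi_eq_Fband_smul]
  · exact b.arcChart_of_gt hκ h7 h7' h

/-- **On `(-∞, parLo (15/4)]` (within the lower core) the arc is the chord piece at the bent clock**
`turnX (αLo t)` (every `u`). [folklore] -/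
theorem arcChart_eq_chordPiece_turnX {u t : ℝ} (ht : t ∈ Icc (b.parLo hκ h7 neg_seven_mem) (b.parLo hκ h7 fifteen_quarters_mem)) :
    b.arcChart hκ h7 h7' u t = b.chordPiece κ u (turnX (b.alphaLo κ t)) := by
  have hc : t ∈ Icc (b.tcLo - b.epsLo / 8) (b.tcLo + b.epsLo / 8) :=
    ⟨le_trans (b.parLo_mem_core hκ h7 neg_seven_mem).1 ht.1, le_trans ht.2 (b.parLo_mem_core hκ h7 fifteen_quarters_mem).2⟩
  rcases le_or_gt t (b.parLo hκ h7 seven_halves_mem) with h | h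
  · rw [b.arcChart_of_le hκ h7 h7' h, turnX_of_le ((b.alphaLo_le_iff' hκ h7 seven_halves_mem hc).2 h)]
  · rw [b.arcChart_of_gt hκ h7 h7' h]
    have h1 : 7 / 2 < b.alphaLo κ t := (b.lt_alphaLo_iff' hκ h7 seven_halves_mem hc).2 h
    have h2 : b.alphaLo κ t ≤ 15 / 4 := (b.alphaLo_le_iff' hκ h7 fifteen_quarters_mem hc).2 ht.2
    have ht5 : t ≤ b.parLo hκ h7 five_mem := le_trans ht.2 (b.parLo_le_parLo hκ h7 fifteen_quarters_mem five_mem (by norm_num))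
    rw [b.deepTrack_of_le hκ h7 h7' ht5, lowerTurn, turnV_of_le h2]
    have hX : 7 / 2 < turnX (b.alphaLo κ t) := by
      have := (turnX_mem_of_le (show b.alphaLo κ t ≤ 4 by linarith)).1; linarith
    rw [b.chordPiece_eq_rail (fun hm ↦ by linarith [hm.2]), b.railLoPsi_eq_Fband_smul]

/-- **At `u = 0` the arc is the band image of the track everywhere** on `[parLo (-7), parHi (-7)]`.
[folklore] -/
theorem arcChart_zero {t : ℝ} (ht : t ∈ Icc (b.parLo hκ h7 neg_seven_mem) (b.parHi hκ h7' neg_seven_mem)) :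
    b.arcChart hκ h7 h7' 0 t = b.Fband (κ • b.deepTrack hκ h7 h7' t) := by
  rcases le_or_gt t (b.parLo hκ h7 seven_halves_mem) with h | h
  · rw [b.arcChart_of_le hκ h7 h7' h, chordPiece_zero]
    have hc : t ∈ Icc (b.tcLo - b.epsLo / 8) (b.tcLo + b.epsLo / 8) :=
      ⟨le_trans (b.parLo_mem_core hκ h7 neg_seven_mem).1 ht.1, le_trans h (b.parLo_mem_core hκ h7 seven_halves_mem).2⟩
    rw [b.deepTrack_of_alphaLo_le hκ h7 h7' hc ((b.alphaLo_le_iff' hκ h7 seven_halves_mem hc).2 h), b.railLoPsi_eq_Fband_smul]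
  · exact b.arcChart_of_gt hκ h7 h7' h

/-- **Off the chord window nothing depends on `u`**: if `αLo t ∉ (5/4, 11/4)` or `t > parLo (7/2)`
then `arcChart u t = arcChart 0 t`. [folklore] -/
theorem arcChart_eq_arcChart_zero {u t : ℝ}
    (ht : ¬ (t ≤ b.parLo hκ h7 seven_halves_mem ∧ b.alphaLo κ t ∈ Ioo (5 / 4 : ℝ) (11 / 4))) :
    b.arcChart hκ h7 h7' u t = b.arcChart hκ h7 h7' 0 t := by
  rcases le_or_gt t (b.parLo hκ h7 seven_halves_mem) with h | h
  · have hα : b.alphaLo κ t ∉ Ioo (5 / 4 : ℝ) (11 / 4) := fun hm ↦ ht ⟨h, hm⟩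
    rw [b.arcChart_of_le hκ h7 h7' h, b.arcChart_of_le hκ h7 h7' h, b.chordPiece_eq_rail hα, chordPiece_zero]
  · rw [b.arcChart_of_gt hκ h7 h7' h, b.arcChart_of_gt hκ h7 h7' h]

/-- **At `u = 1` on the chord window the arc is the straight chord line.** [folklore] -/
theorem arcChart_one_of_mem {t : ℝ} (hc : t ∈ Icc (b.tcLo - b.epsLo / 8) (b.tcLo + b.epsLo / 8))
    (hα : b.alphaLo κ t ∈ Icc (3 / 2 : ℝ) (5 / 2)) : b.arcChart hκ h7 h7' 1 t = b.chordLine κ (b.alphaLo κ t) := by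
  have ht : t ≤ b.parLo hκ h7 seven_halves_mem := (b.alphaLo_le_iff' hκ h7 seven_halves_mem hc).1 (by linarith [hα.2])
  rw [b.arcChart_of_le hκ h7 h7' ht, b.chordPiece_one_eq_chordLine hα]


/-- **Below the chord window on the lower core the arc is the lower neck** (`αLo t ≤ 5/4`, every
`u`). [folklore] -/
theorem arcChart_eq_railLoPsi_of_le {u t : ℝ} (hc : t ∈ Icc (b.tcLo - b.epsLo / 8) (b.tcLo + b.epsLo / 8))
    (hα : b.alphaLo κ t ≤ 5 / 4) : b.arcChart hκ h7 h7' u t = b.railLoPsi κ (b.alphaLo κ t) := by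
  have ht : t ≤ b.parLo hκ h7 seven_halves_mem := (b.alphaLo_le_iff' hκ h7 seven_halves_mem hc).1 (by linarith)
  rw [b.arcChart_of_le hκ h7 h7' ht, b.chordPiece_eq_rail (fun hm ↦ by linarith [hm.1])]

/-- **On the upper core with `αHi t ≤ 7/2` the arc is the upper neck** (every `u`). [folklore] -/
theorem arcChart_eq_railHiPsi_of_le {u t : ℝ} (hc : t ∈ Icc (b.tcHi - b.epsHi / 8) (b.tcHi + b.epsHi / 8))
    (hα : b.alphaHi κ t ≤ 7 / 2) : b.arcChart hκ h7 h7' u t = b.railHiPsi κ (b.alphaHi κ t) := by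
  have h5 : b.parHi hκ h7' five_mem ≤ t := (b.alphaHi_le_iff' hκ h7' five_mem hc).1 (by linarith)
  have hgt : b.parLo hκ h7 seven_halves_mem < t := by
    have h1 := (b.parLo_mem_core hκ h7 seven_halves_mem).2
    have h2 := (b.parHi_mem_core hκ h7' five_mem).1
    have := b.core_marks; linarith
  rw [b.arcChart_of_gt hκ h7 h7' hgt, b.deepTrack_of_alphaHi_le hκ h7 h7' hc hα, b.railHiPsi_eq_Fband_smul]

/-- **Neck or deep**: the planar track has second coordinate `∓1` (a neck line) or first
coordinate `≥ 7/2`. [folklore] -/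
theorem abs_deepTrack_one_eq_one_or (t : ℝ) :
    |b.deepTrack hκ h7 h7' t 1| = 1 ∨ 7 / 2 ≤ b.deepTrack hκ h7 h7' t 0 := by
  rcases le_or_gt t (b.parLo hκ h7 five_mem) with h5 | h5
  · rw [b.deepTrack_of_le hκ h7 h7' h5]
    rcases le_or_gt (b.alphaLo κ t) (7 / 2) with hα | hα
    · left; rw [lowerTurn_of_le hα, pt2_apply_one]; norm_num
    · right
      show 7 / 2 ≤ (pt2 (turnX (b.alphaLo κ t)) (turnV (b.alphaLo κ t)) : 𝔼 2) 0
      rw [pt2_apply_zero]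
      rcases le_or_gt (b.alphaLo κ t) 4 with h4 | h4
      · have := (turnX_mem_of_le h4).1; linarith
      · have := (turnX_le_of_ge h4.le).1; linarith
  rcases lt_or_ge t (b.parHi hκ h7' five_mem) with h5' | h5'
  · right; rw [b.deepTrack_of_mem hκ h7 h7' ⟨h5, h5'⟩, pt2_apply_zero]; norm_num
  · rw [b.deepTrack_of_ge hκ h7 h7' h5']
    rcases le_or_gt (b.alphaHi κ t) (7 / 2) with hα | hα
    · left; rw [upperTurn_of_le hα, pt2_apply_one]; norm_num
    · right
      show 7 / 2 ≤ (pt2 (turnX (b.alphaHi κ t)) (-turnV (b.alphaHi κ t)) : 𝔼 2) 0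
      rw [pt2_apply_zero]
      rcases le_or_gt (b.alphaHi κ t) 4 with h4 | h4
      · have := (turnX_mem_of_le h4).1; linarith
      · have := (turnX_le_of_ge h4.le).1; linarith

/-! ### Smoothness -/

section Smooth

variable (h9 : κ * 9 ≤ b.poleRad hcross)
include h9

/-- The bent-clock rail parameter is pole-free on the lower zone. [folklore] -/
theorem norm_railParam_turnX_lt {t : ℝ} (ht : t ∈ Icc (b.parLo hκ h7 neg_seven_mem) (b.parLo hκ h7 five_mem)) :
    ‖(pt2 (κ * turnX (b.alphaLo κ t)) (-κ) : 𝔼 2)‖ < b.poleRad hcross := by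
  have ha := b.alphaLo_mem_of_zone hκ h7 ht
  have hX : |turnX (b.alphaLo κ t)| ≤ 7 := by
    rcases le_or_gt (b.alphaLo κ t) 4 with h4 | h4
    · have := turnX_mem_of_le h4; exact abs_le.2 ⟨by linarith [this.1, ha.1], by linarith [this.2]⟩
    · have := turnX_le_of_ge h4.le; exact abs_le.2 ⟨by linarith [this.1], by linarith [this.2, ha.2]⟩
  refine lt_of_le_of_lt (norm_railParam_le hκ _ (-1) (by simp) |>.trans_eq' (by rw [neg_one_mul])) ?_
  nlinarith

/-- The scaled track is pole-free. [folklore] -/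
theorem norm_smul_deepTrack_lt {t : ℝ} (ht : t ∈ Icc (b.parLo hκ h7 neg_seven_mem) (b.parHi hκ h7' neg_seven_mem)) :
    ‖κ • b.deepTrack hκ h7 h7' t‖ < b.poleRad hcross := by
  rw [norm_smul, Real.norm_eq_abs, abs_of_pos hκ]
  have := b.norm_deepTrack_le hκ h7 h7' ht
  nlinarith

/-- **The deep arc is jointly `C^∞`** at every `(u, t)` with `t ∈ (parLo (-7), parHi (-7))`.
[folklore] -/
theorem contDiffAt_arcChart {u t : ℝ} (ht : t ∈ Ioo (b.parLo hκ h7 neg_seven_mem) (b.parHi hκ h7' neg_seven_mem)) :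
    ContDiffAt ℝ ∞ (uncurry (b.arcChart hκ h7 h7')) (u, t) := by
  have h1115 : b.parLo hκ h7 eleven_quarters_mem < b.parLo hκ h7 fifteen_quarters_mem :=
    b.parLo_lt_parLo hκ h7 eleven_quarters_mem fifteen_quarters_mem (by norm_num)
  rcases lt_or_ge t (b.parLo hκ h7 fifteen_quarters_mem) with h | h
  · -- the chord formula at the bent clock
    have hev : uncurry (b.arcChart hκ h7 h7') =ᶠ[𝓝 (u, t)] fun p : ℝ × ℝ ↦ b.chordPiece κ p.1 (turnX (b.alphaLo κ p.2)) := by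
      have hopen : IsOpen {p : ℝ × ℝ | p.2 ∈ Ioo (b.parLo hκ h7 neg_seven_mem) (b.parLo hκ h7 fifteen_quarters_mem)} :=
        isOpen_Ioo.preimage continuous_snd
      filter_upwards [hopen.mem_nhds (show (u, t) ∈ {p : ℝ × ℝ | p.2 ∈ Ioo _ _} from ⟨ht.1, h⟩)] with p hp
      exact b.arcChart_eq_chordPiece_turnX hκ h7 h7' ⟨hp.1.le, hp.2.le⟩
    refine ContDiffAt.congr_of_eventuallyEq ?_ hev
    have hθ : ContDiffAt ℝ ∞ (fun p : ℝ × ℝ ↦ (p.1, turnX (b.alphaLo κ p.2))) (u, t) :=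
      contDiffAt_fst.prodMk ((contDiff_turnX.comp (b.contDiff_alphaLo κ)).contDiffAt.comp (u, t) contDiffAt_snd)
    have h5 : t ≤ b.parLo hκ h7 five_mem := le_trans h.le (b.parLo_le_parLo hκ h7 fifteen_quarters_mem five_mem (by norm_num))
    have hC := b.contDiffAt_chordPiece hcross (κ := κ) (u := u) (b.norm_railParam_turnX_lt hcross hκ h7 h9 ⟨ht.1.le, h5⟩)
    exact ContDiffAt.comp (g := uncurry (b.chordPiece κ)) (f := fun p : ℝ × ℝ ↦ (p.1, turnX (b.alphaLo κ p.2))) (u, t) hC hθ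
  · -- the band formula
    have hev : uncurry (b.arcChart hκ h7 h7') =ᶠ[𝓝 (u, t)] fun p : ℝ × ℝ ↦ b.Fband (κ • b.deepTrack hκ h7 h7' p.2) := by
      have hopen : IsOpen {p : ℝ × ℝ | p.2 ∈ Ioo (b.parLo hκ h7 eleven_quarters_mem) (b.parHi hκ h7' neg_seven_mem)} :=
        isOpen_Ioo.preimage continuous_snd
      filter_upwards [hopen.mem_nhds (show (u, t) ∈ {p : ℝ × ℝ | p.2 ∈ Ioo _ _} from ⟨by linarith, ht.2⟩)] with p hp
      exact b.arcChart_eq_band hκ h7 h7' ⟨hp.1.le, hp.2.le⟩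
    refine ContDiffAt.congr_of_eventuallyEq ?_ hev
    have hq : ContDiffAt ℝ ∞ (fun p : ℝ × ℝ ↦ κ • b.deepTrack hκ h7 h7' p.2) (u, t) :=
      (((b.contDiff_deepTrack hκ h7 h7').comp contDiff_snd).const_smul κ).contDiffAt
    exact ContDiffAt.comp (g := b.Fband) (f := fun p : ℝ × ℝ ↦ κ • b.deepTrack hκ h7 h7' p.2) (u, t)
      (b.contDiffAt_Fband hcross (b.norm_smul_deepTrack_lt hcross hκ h7 h7' h9 ⟨ht.1.le, ht.2.le⟩)) hq

/-- The deep arc at fixed `u` is `C^∞` at every `t ∈ (parLo (-7), parHi (-7))`. [folklore] -/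
theorem contDiffAt_arcChart_right (u : ℝ) {t : ℝ} (ht : t ∈ Ioo (b.parLo hκ h7 neg_seven_mem) (b.parHi hκ h7' neg_seven_mem)) :
    ContDiffAt ℝ ∞ (b.arcChart hκ h7 h7' u) t :=
  (b.contDiffAt_arcChart hcross hκ h7 h7' h9 ht).comp t (contDiffAt_const.prodMk contDiffAt_id)

end Smooth

/-! ### The arc is south -/

include hcross in
/-- **The deep arc is exactly in the open southern chart ball** between the centres of the cores
(`u ∈ [0, 1]`, `B` south, `9κ < 1/2`). [folklore] -/
theorem norm_arcChart_lt_two (hB : B.InSouth) (hκ2 : κ * 9 < 2⁻¹) {u : ℝ} (hu : u ∈ Icc (0 : ℝ) 1) {t : ℝ}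
    (ht : t ∈ Ioo b.tcLo b.tcHi) (ht' : t ≤ b.parHi hκ h7' neg_seven_mem) : ‖b.arcChart hκ h7 h7' u t‖ < 2 := by
  have hz : b.parLo hκ h7 (v := 0) ⟨by norm_num, by norm_num⟩ = b.tcLo := b.parLo_zero hκ h7
  have hz' : b.parHi hκ h7' (v := 0) ⟨by norm_num, by norm_num⟩ = b.tcHi := b.parHi_zero hκ h7'
  have ht7 : b.parLo hκ h7 neg_seven_mem ≤ t := by
    have h1 := b.parLo_le_parLo hκ h7 neg_seven_mem (w := 0) ⟨by norm_num, by norm_num⟩ (by norm_num)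
    rw [hz] at h1; linarith [ht.1]
  rcases le_or_gt t (b.parLo hκ h7 fifteen_quarters_mem) with h | h
  · rw [b.arcChart_eq_chordPiece_turnX hκ h7 h7' ⟨ht7, h⟩]
    have hc : t ∈ Icc (b.tcLo - b.epsLo / 8) (b.tcLo + b.epsLo / 8) :=
      ⟨by linarith [ht.1, b.epsLo_bounds.1], le_trans h (b.parLo_mem_core hκ h7 fifteen_quarters_mem).2⟩
    have ha0 : 0 < b.alphaLo κ t := by
      have := (b.lt_alphaLo_iff' hκ h7 (v := 0) ⟨by norm_num, by norm_num⟩ hc).2 (by rw [hz]; exact ht.1); exact this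
    have ha4 : b.alphaLo κ t ≤ 15 / 4 := (b.alphaLo_le_iff' hκ h7 fifteen_quarters_mem hc).2 h
    have hX := turnX_mem_of_le (show b.alphaLo κ t ≤ 4 by linarith)
    refine b.norm_chordPiece_lt_two hcross hB hκ (by nlinarith) hu (by linarith [hX.1]) ?_
    rw [abs_of_pos (by linarith [hX.1])]; nlinarith [hX.2]
  · have h11 : b.parLo hκ h7 eleven_quarters_mem ≤ t := le_trans (b.parLo_le_parLo hκ h7 eleven_quarters_mem fifteen_quarters_mem (by norm_num)) h.le
    rw [b.arcChart_eq_band hκ h7 h7' ⟨h11, ht'⟩]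
    have hq : ‖κ • b.deepTrack hκ h7 h7' t‖ < 2⁻¹ := by
      rw [norm_smul, Real.norm_eq_abs, abs_of_pos hκ]
      have := b.norm_deepTrack_le hκ h7 h7' ⟨ht7, ht'⟩; nlinarith
    refine b.norm_Fband_lt_two (hcross := hcross) hB hq ?_
    -- the first planar coordinate of the track is positive
    show 0 < (κ • b.deepTrack hκ h7 h7' t) 0
    rw [PiLp.smul_apply, smul_eq_mul]
    refine mul_pos hκ ?_
    rcases le_or_gt t (b.parLo hκ h7 five_mem) with h1 | h1
    · rw [b.deepTrack_of_le hκ h7 h7' h1, lowerTurn_apply_zero]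
      have hc : t ∈ Icc (b.tcLo - b.epsLo / 8) (b.tcLo + b.epsLo / 8) :=
        ⟨by linarith [ht.1, b.epsLo_bounds.1], le_trans h1 (b.parLo_mem_core hκ h7 five_mem).2⟩
      have ha : 15 / 4 < b.alphaLo κ t := (b.lt_alphaLo_iff' hκ h7 fifteen_quarters_mem hc).2 h
      rcases le_or_gt (b.alphaLo κ t) 4 with h4 | h4
      · linarith [(turnX_mem_of_le h4).1]
      · linarith [(turnX_le_of_ge h4.le).1]
    rcases lt_or_ge t (b.parHi hκ h7' five_mem) with h2 | h2
    · rw [b.deepTrack_of_mem hκ h7 h7' ⟨h1, h2⟩, pt2_apply_zero]; norm_num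
    · rw [b.deepTrack_of_ge hκ h7 h7' h2, upperTurn_apply_zero]
      have hc : t ∈ Icc (b.tcHi - b.epsHi / 8) (b.tcHi + b.epsHi / 8) :=
        ⟨le_trans (b.parHi_mem_core hκ h7' five_mem).1 h2, by linarith [ht.2, b.epsHi_bounds.1]⟩
      have ha0 : 0 < b.alphaHi κ t := (b.lt_alphaHi_iff' hκ h7' (v := 0) ⟨by norm_num, by norm_num⟩ hc).2 (by rw [hz']; exact ht.2)
      rcases le_or_gt (b.alphaHi κ t) 4 with h4 | h4
      · linarith [(turnX_mem_of_le h4).1]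
      · linarith [(turnX_le_of_ge h4.le).1]

include hcross in
/-- **The deep arc on the sphere is in the open southern hemisphere** (same hypotheses). [folklore] -/
theorem coe_psiN_symm_arcChart_last_neg (hB : B.InSouth) (hκ2 : κ * 9 < 2⁻¹) {u : ℝ} (hu : u ∈ Icc (0 : ℝ) 1) {t : ℝ}
    (ht : t ∈ Ioo b.tcLo b.tcHi) (ht' : t ≤ b.parHi hκ h7' neg_seven_mem) :
    ((psiN.symm (b.arcChart hκ h7 h7' u t) : 𝕊 3) : 𝔼 4) (Fin.last 3) < 0 := by
  have h := b.norm_arcChart_lt_two hcross hκ h7 h7' hB hκ2 hu ht ht'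
  rw [← psiN_apply_psiN_symm (b.arcChart hκ h7 h7' u t)] at h
  exact (norm_psiN_lt_two_iff (psiN_symm_ne_northPole _)).1 h

/-! ### Flat estimates -/

omit hκ h7 h7' in
/-- Coordinates of a difference with `pt3`. [folklore] -/
theorem sub_pt3_apply_zero (Y : 𝔼 3) (x y z : ℝ) : (Y - pt3 x y z) 0 = Y 0 - x := by simp

omit hκ h7 h7' in
/-- Coordinates of a difference with `pt3`. [folklore] -/
theorem sub_pt3_apply_one (Y : 𝔼 3) (x y z : ℝ) : (Y - pt3 x y z) 1 = Y 1 - y := by simp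

section Flat

variable {hcross} {ε r : ℝ} (hf : b.IsFlat hcross ε r) (h9r : κ * 9 < r)
include hκ hf h9r

omit h7 h7' h9r in
/-- **Flatness for scaled planar parameters**: `‖blowUp κ (Fband (κ • q)) - (q₀, q₁, 0)‖ ≤ ε ‖q‖`
when `‖κ • q‖ < r`. [folklore] -/
theorem norm_blowUp_Fband_smul_sub_le (q : 𝔼 2) (hq : ‖κ • q‖ < r) :
    ‖b.blowUp hcross κ (b.Fband (κ • q)) - pt3 (q 0) (q 1) 0‖ ≤ ε * ‖q‖ := by
  have key := hf.flat (κ • q) 0 hq (by simpa using hf.r_pos)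
  have hF0 : b.Fband 0 = b.pZero := rfl
  rw [hF0, sub_zero] at key
  have e : b.blowUp hcross κ (b.Fband (κ • q)) - pt3 (q 0) (q 1) 0 =
      κ⁻¹ • ((b.frame hcross).symm (b.Fband (κ • q) - b.pZero) -
        WithLp.toLp 2 ![(κ • q) 0 - (0 : 𝔼 2) 0, (κ • q) 1 - (0 : 𝔼 2) 1, 0]) := by
    rw [smul_sub, blowUp]
    congr 1
    ext i; fin_cases i <;> simp <;> field_simp
  rw [e, norm_smul, Real.norm_eq_abs, abs_inv, abs_of_pos hκ]
  have hε : 0 ≤ ε := hf.eps_nonneg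
  calc κ⁻¹ * _ ≤ κ⁻¹ * (ε * ‖κ • q‖) := by gcongr
    _ = ε * ‖q‖ := by rw [norm_smul, Real.norm_eq_abs, abs_of_pos hκ]; field_simp

omit hf in
/-- The scaled track is in the flat ball. [folklore] -/
theorem norm_smul_deepTrack_lt_r {t : ℝ} (ht : t ∈ Icc (b.parLo hκ h7 neg_seven_mem) (b.parHi hκ h7' neg_seven_mem)) :
    ‖κ • b.deepTrack hκ h7 h7' t‖ < r := by
  rw [norm_smul, Real.norm_eq_abs, abs_of_pos hκ]
  have := b.norm_deepTrack_le hκ h7 h7' ht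
  nlinarith

/-- **Blow-up coordinates of the arc on the band zone** `[parLo (11/4), parHi (-7)]`: within `8 ε` of
`(q₀, q₁, 0)`, `q` the planar track. [folklore] -/
theorem norm_blowUp_arcChart_sub_le_band {u t : ℝ} (ht : t ∈ Icc (b.parLo hκ h7 eleven_quarters_mem) (b.parHi hκ h7' neg_seven_mem)) :
    ‖b.blowUp hcross κ (b.arcChart hκ h7 h7' u t) - pt3 (b.deepTrack hκ h7 h7' t 0) (b.deepTrack hκ h7 h7' t 1) 0‖ ≤ 8 * ε := by
  have ht' : t ∈ Icc (b.parLo hκ h7 neg_seven_mem) (b.parHi hκ h7' neg_seven_mem) :=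
    ⟨le_trans (b.parLo_le_parLo hκ h7 neg_seven_mem eleven_quarters_mem (by norm_num)) ht.1, ht.2⟩
  rw [b.arcChart_eq_band hκ h7 h7' ht]
  refine (b.norm_blowUp_Fband_smul_sub_le hκ hf _ (b.norm_smul_deepTrack_lt_r hκ h7 h7' h9r ht')).trans ?_
  have := b.norm_deepTrack_le hκ h7 h7' ht'
  have hε := hf.eps_nonneg
  nlinarith

/-- **Blow-up coordinates of the arc on the chord zone** `[parLo (-7), parLo (15/4)]`: within `8 ε`
of `(θ, -1, 0)`, `θ = turnX (αLo t)` the bent clock. [folklore] -/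
theorem norm_blowUp_arcChart_sub_le_chord {u : ℝ} (hu : u ∈ Icc (0 : ℝ) 1) {t : ℝ}
    (ht : t ∈ Icc (b.parLo hκ h7 neg_seven_mem) (b.parLo hκ h7 fifteen_quarters_mem)) :
    ‖b.blowUp hcross κ (b.arcChart hκ h7 h7' u t) - pt3 (turnX (b.alphaLo κ t)) (-1) 0‖ ≤ 8 * ε := by
  rw [b.arcChart_eq_chordPiece_turnX hκ h7 h7' ht]
  have h5 : t ≤ b.parLo hκ h7 five_mem := le_trans ht.2 (b.parLo_le_parLo hκ h7 fifteen_quarters_mem five_mem (by norm_num))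
  have ha := b.alphaLo_mem_of_zone hκ h7 ⟨ht.1, h5⟩
  set θ := turnX (b.alphaLo κ t) with hθ
  have hθ7 : |θ| ≤ 7 := by
    rcases le_or_gt (b.alphaLo κ t) 4 with h4 | h4
    · have := turnX_mem_of_le h4; exact abs_le.2 ⟨by linarith [this.1, ha.1], by linarith [this.2]⟩
    · have := turnX_le_of_ge h4.le; exact abs_le.2 ⟨by linarith [this.1], by linarith [this.2, ha.2]⟩
  have hsc : κ * (|θ| + 1) < r := by nlinarith
  have hε := hf.eps_nonneg
  by_cases h3 : |θ| ≤ 3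
  · exact (b.norm_blowUp_chordPiece_sub_le hf hκ (by linarith) hu hsc h3).trans (by linarith)
  · have hrail : b.chordPiece κ u θ = b.railLoPsi κ θ := b.chordPiece_eq_rail (fun hm ↦ h3 (abs_le.2 ⟨by linarith [hm.1], by linarith [hm.2]⟩))
    rw [hrail]
    exact (b.norm_blowUp_railLoPsi_sub_le hf hκ hsc).trans (by nlinarith)

/-- **The blow-up norm of the arc is at most `8 + 8ε`** on `[parLo (-7), parHi (-7)]` (`u ∈ [0, 1]`).
[folklore] -/
theorem norm_blowUp_arcChart_le {u : ℝ} (hu : u ∈ Icc (0 : ℝ) 1) {t : ℝ}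
    (ht : t ∈ Icc (b.parLo hκ h7 neg_seven_mem) (b.parHi hκ h7' neg_seven_mem)) :
    ‖b.blowUp hcross κ (b.arcChart hκ h7 h7' u t)‖ ≤ 8 + 8 * ε := by
  rcases le_or_gt t (b.parLo hκ h7 fifteen_quarters_mem) with h | h
  · have h1 := b.norm_blowUp_arcChart_sub_le_chord hκ h7 h7' hf h9r hu ⟨ht.1, h⟩
    have h5 : t ≤ b.parLo hκ h7 five_mem := le_trans h (b.parLo_le_parLo hκ h7 fifteen_quarters_mem five_mem (by norm_num))
    have ha := b.alphaLo_mem_of_zone hκ h7 ⟨ht.1, h5⟩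
    have hθ7 : |turnX (b.alphaLo κ t)| ≤ 7 := by
      rcases le_or_gt (b.alphaLo κ t) 4 with h4 | h4
      · have := turnX_mem_of_le h4; exact abs_le.2 ⟨by linarith [this.1, ha.1], by linarith [this.2]⟩
      · have := turnX_le_of_ge h4.le; exact abs_le.2 ⟨by linarith [this.1], by linarith [this.2, ha.2]⟩
    have h0 : ‖(pt3 (turnX (b.alphaLo κ t)) (-1) 0 : 𝔼 3)‖ ≤ 8 := (norm_pt3_le _ _ _).trans (by simp; linarith)
    linarith [norm_sub_norm_le (b.blowUp hcross κ (b.arcChart hκ h7 h7' u t)) (pt3 (turnX (b.alphaLo κ t)) (-1) 0)]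
  · have h11 : b.parLo hκ h7 eleven_quarters_mem ≤ t :=
      le_trans (b.parLo_le_parLo hκ h7 eleven_quarters_mem fifteen_quarters_mem (by norm_num)) h.le
    have h1 := b.norm_blowUp_arcChart_sub_le_band hκ h7 h7' hf h9r (u := u) ⟨h11, ht.2⟩
    have hq := b.norm_deepTrack_le hκ h7 h7' ht
    have h0 : ‖(pt3 (b.deepTrack hκ h7 h7' t 0) (b.deepTrack hκ h7 h7' t 1) 0 : 𝔼 3)‖ ≤ 8 := by
      have e : ‖(pt3 (b.deepTrack hκ h7 h7' t 0) (b.deepTrack hκ h7 h7' t 1) 0 : 𝔼 3)‖ = ‖b.deepTrack hκ h7 h7' t‖ := by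
        rw [EuclideanSpace.norm_eq, EuclideanSpace.norm_eq]; simp [Fin.sum_univ_three, Fin.sum_univ_two]
      rw [e]; exact hq
    linarith [norm_sub_norm_le (b.blowUp hcross κ (b.arcChart hκ h7 h7' u t)) (pt3 (b.deepTrack hκ h7 h7' t 0) (b.deepTrack hκ h7 h7' t 1) 0)]

/-- **The arc is within `9κ ‖frame‖` of `pZero`** (`ε ≤ 1/8`). [folklore] -/
theorem norm_arcChart_sub_pZero_le (hε8 : ε ≤ 1 / 8) {u : ℝ} (hu : u ∈ Icc (0 : ℝ) 1) {t : ℝ}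
    (ht : t ∈ Icc (b.parLo hκ h7 neg_seven_mem) (b.parHi hκ h7' neg_seven_mem)) :
    ‖b.arcChart hκ h7 h7' u t - b.pZero‖ ≤ 9 * κ * ‖((b.frame hcross : (𝔼 3) ≃L[ℝ] 𝔼 3) : (𝔼 3) →L[ℝ] 𝔼 3)‖ := by
  have h1 := b.norm_sub_pZero_le hκ (hcross := hcross) (b.arcChart hκ h7 h7' u t)
  have h2 := b.norm_blowUp_arcChart_le hκ h7 h7' hf h9r hu ht
  calc _ ≤ κ * ‖((b.frame hcross : (𝔼 3) ≃L[ℝ] 𝔼 3) : (𝔼 3) →L[ℝ] 𝔼 3)‖ * ‖b.blowUp hcross κ (b.arcChart hκ h7 h7' u t)‖ := h1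
    _ ≤ κ * ‖((b.frame hcross : (𝔼 3) ≃L[ℝ] 𝔼 3) : (𝔼 3) →L[ℝ] 𝔼 3)‖ * 9 :=
        mul_le_mul_of_nonneg_left (by linarith) (mul_nonneg hκ.le (norm_nonneg _))
    _ = _ := by ring

/-- **The first blow-up coordinate of the arc on `[parLo v, parHi v]` is at least `v - 8ε`**
(`v ∈ [-3, 11/4]`, `u ∈ [0, 1]`). [folklore] -/
theorem blowUp_arcChart_zero_ge {v : ℝ} (hv : v ∈ Icc (-3 : ℝ) (11 / 4)) {u : ℝ} (hu : u ∈ Icc (0 : ℝ) 1) {t : ℝ}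
    (ht : t ∈ Icc (b.parLo hκ h7 (v := v) ⟨by linarith [hv.1], by linarith [hv.2]⟩) (b.parHi hκ h7' (v := v) ⟨by linarith [hv.1], by linarith [hv.2]⟩)) :
    v - 8 * ε ≤ b.blowUp hcross κ (b.arcChart hκ h7 h7' u t) 0 := by
  have hv7 : v ∈ Icc (-7 : ℝ) 7 := ⟨by linarith [hv.1], by linarith [hv.2]⟩
  have htlo : b.parLo hκ h7 neg_seven_mem ≤ t := le_trans (b.parLo_le_parLo hκ h7 neg_seven_mem hv7 (by linarith [hv.1])) ht.1
  have hthi : t ≤ b.parHi hκ h7' neg_seven_mem := le_trans ht.2 (b.parHi_le_parHi hκ h7' neg_seven_mem hv7 (by linarith [hv.1]))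
  rcases le_or_gt t (b.parLo hκ h7 fifteen_quarters_mem) with h | h
  · have h1 := b.norm_blowUp_arcChart_sub_le_chord hκ h7 h7' hf h9r hu ⟨htlo, h⟩
    have hc : t ∈ Icc (b.tcLo - b.epsLo / 8) (b.tcLo + b.epsLo / 8) :=
      ⟨le_trans (b.parLo_mem_core hκ h7 neg_seven_mem).1 htlo, le_trans h (b.parLo_mem_core hκ h7 fifteen_quarters_mem).2⟩
    have ha1 : v ≤ b.alphaLo κ t := (b.le_alphaLo_iff' hκ h7 hv7 hc).2 ht.1
    have ha2 : b.alphaLo κ t ≤ 15 / 4 := (b.alphaLo_le_iff' hκ h7 fifteen_quarters_mem hc).2 h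
    have hX := (turnX_mem_of_le (show b.alphaLo κ t ≤ 4 by linarith)).1
    have := (BandFoliation.abs_apply_le_norm _ 0).trans h1
    rw [sub_pt3_apply_zero] at this
    linarith [(abs_le.1 this).1]
  · have h11 : b.parLo hκ h7 eleven_quarters_mem ≤ t :=
      le_trans (b.parLo_le_parLo hκ h7 eleven_quarters_mem fifteen_quarters_mem (by norm_num)) h.le
    have h1 := b.norm_blowUp_arcChart_sub_le_band hκ h7 h7' hf h9r (u := u) ⟨h11, hthi⟩
    have := (BandFoliation.abs_apply_le_norm _ 0).trans h1
    rw [sub_pt3_apply_zero] at this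
    have hq0 : v ≤ b.deepTrack hκ h7 h7' t 0 := by
      rcases le_or_gt t (b.parLo hκ h7 five_mem) with h1 | h1
      · rw [b.deepTrack_of_le hκ h7 h7' h1, lowerTurn_apply_zero]
        have hc : t ∈ Icc (b.tcLo - b.epsLo / 8) (b.tcLo + b.epsLo / 8) :=
          ⟨le_trans (b.parLo_mem_core hκ h7 neg_seven_mem).1 htlo, le_trans h1 (b.parLo_mem_core hκ h7 five_mem).2⟩
        have ha : 15 / 4 < b.alphaLo κ t := (b.lt_alphaLo_iff' hκ h7 fifteen_quarters_mem hc).2 h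
        rcases le_or_gt (b.alphaLo κ t) 4 with h4 | h4
        · linarith [(turnX_mem_of_le h4).1, hv.2]
        · linarith [(turnX_le_of_ge h4.le).1, hv.2]
      rcases lt_or_ge t (b.parHi hκ h7' five_mem) with h2 | h2
      · rw [b.deepTrack_of_mem hκ h7 h7' ⟨h1, h2⟩, pt2_apply_zero]; linarith [hv.2]
      · rw [b.deepTrack_of_ge hκ h7 h7' h2, upperTurn_apply_zero]
        have hc : t ∈ Icc (b.tcHi - b.epsHi / 8) (b.tcHi + b.epsHi / 8) :=
          ⟨le_trans (b.parHi_mem_core hκ h7' five_mem).1 h2, le_trans hthi (b.parHi_mem_core hκ h7' neg_seven_mem).2⟩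
        have ha1 : v ≤ b.alphaHi κ t := (b.le_alphaHi_iff' hκ h7' hv7 hc).2 ht.2
        rcases le_or_gt (b.alphaHi κ t) 4 with h4 | h4
        · linarith [(turnX_mem_of_le h4).1]
        · linarith [(turnX_le_of_ge h4.le).1, hv.2]
    linarith [(abs_le.1 this).1]

/-! ### Regularity -/

omit hκ h7 h7' h9r in
/-- **The differential of `Fband` is injective in the flat regime** (`ε < 1`). [folklore] -/
theorem fderiv_Fband_ne_zero (hε1 : ε < 1) {q : 𝔼 2} (hq : ‖q‖ < r) {w : 𝔼 2} (hw : w ≠ 0) : fderiv ℝ b.Fband q w ≠ 0 := by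
  intro h0
  have key := hf.flat_fderiv q hq w
  rw [h0, map_zero, zero_sub, norm_neg, norm_inl_eq w] at key
  have hwpos : 0 < ‖w‖ := norm_pos_iff.2 hw
  nlinarith

omit h7 h7' h9r in
/-- The rail has nonzero derivative in the flat regime (`ε < 1`). [folklore] -/
theorem deriv_railLoPsi_ne_zero (hε1 : ε < 1) {α : ℝ} (hα : κ * (|α| + 1) < r) : deriv (b.railLoPsi κ) α ≠ 0 := by
  have hq := norm_railLoParam_lt hκ hα
  rw [(b.hasDerivAt_railLoPsi (hq.trans_le hf.r_le)).deriv]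
  refine smul_ne_zero hκ.ne' (b.fderiv_Fband_ne_zero hf hε1 hq ?_)
  intro h; have := congrArg (fun p : 𝔼 2 ↦ p 0) h; simp at this

omit h7 h7' in
/-- **The chord piece has nonzero derivative on `[-7, 4]`** (`u ∈ [0, 1]`, `ε (6 + 8 B_c) ≤ 1/2`, `ε < 1`).
[folklore] -/
theorem deriv_chordPiece_ne_zero (hgood : ε * (6 + 8 * chordBumpBound) ≤ 1 / 2) (hε1 : ε < 1) {u : ℝ} (hu : u ∈ Icc (0 : ℝ) 1)
    {θ : ℝ} (hθ : θ ∈ Icc (-7 : ℝ) 4) : deriv (b.chordPiece κ u) θ ≠ 0 := by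
  have hθ7 : |θ| ≤ 7 := abs_le.2 ⟨hθ.1, by linarith [hθ.2]⟩
  have hsc : κ * (|θ| + 1) < r := by nlinarith
  by_cases h3 : |θ| ≤ 3
  · have hd : HasDerivAt (b.chordPiece κ u) (deriv (b.chordPiece κ u) θ) θ := by
      have hq : ‖(pt2 (κ * θ) (-κ) : 𝔼 2)‖ < b.poleRad hcross := (norm_railLoParam_lt hκ hsc).trans_le hf.r_le
      have h := (b.contDiffAt_chordPiece hcross (κ := κ) (u := u) hq).comp θ ((contDiffAt_const (c := u)).prodMk contDiffAt_id)
      exact (h.differentiableAt (by simp)).hasDerivAt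
    exact b.ne_zero_of_hasDerivAt_chordPiece hf hκ (by linarith) hu h3 hgood hd
  · -- beyond `3` (hence `> 11/4` or `< -3`): the chord piece is the rail near `θ`
    have hθ' : θ ∉ Icc (5 / 4 : ℝ) (11 / 4) := fun hm ↦ h3 (abs_le.2 ⟨by linarith [hm.1], by linarith [hm.2]⟩)
    have hev : b.chordPiece κ u =ᶠ[𝓝 θ] b.railLoPsi κ := by
      rcases lt_or_gt_of_ne (fun h : θ = 11 / 4 ↦ hθ' (by rw [h]; exact ⟨by norm_num, le_rfl⟩)) with hlt | hgt
      · have hlt' : θ < 5 / 4 := by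
          by_contra hge; push Not at hge; exact hθ' ⟨hge, hlt.le⟩
        filter_upwards [Iio_mem_nhds hlt'] with x hx using b.chordPiece_eq_rail (fun hm ↦ by linarith [hm.1, hx.out])
      · filter_upwards [Ioi_mem_nhds hgt] with x hx using b.chordPiece_eq_rail (fun hm ↦ by linarith [hm.2, hx.out])
    rw [hev.deriv_eq]
    exact b.deriv_railLoPsi_ne_zero hκ hf hε1 hsc

/-- **The deep arc is regular on `[parLo (-7), parHi (-7)]`** (interior points) for `u ∈ [0, 1]`.
[folklore] -/
theorem deriv_arcChart_ne_zero (hgood : ε * (6 + 8 * chordBumpBound) ≤ 1 / 2) (hε1 : ε < 1) {u : ℝ} (hu : u ∈ Icc (0 : ℝ) 1)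
    {t : ℝ} (ht : t ∈ Ioo (b.parLo hκ h7 neg_seven_mem) (b.parHi hκ h7' neg_seven_mem)) :
    deriv (b.arcChart hκ h7 h7' u) t ≠ 0 := by
  rcases lt_or_ge t (b.parLo hκ h7 fifteen_quarters_mem) with h | h
  · -- chord zone: chain rule through the bent clock
    have hev : b.arcChart hκ h7 h7' u =ᶠ[𝓝 t] fun t ↦ b.chordPiece κ u (turnX (b.alphaLo κ t)) := by
      filter_upwards [Ioo_mem_nhds ht.1 h] with s hs using b.arcChart_eq_chordPiece_turnX hκ h7 h7' ⟨hs.1.le, hs.2.le⟩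
    rw [hev.deriv_eq]
    have h5 : t ≤ b.parLo hκ h7 five_mem := le_trans h.le (b.parLo_le_parLo hκ h7 fifteen_quarters_mem five_mem (by norm_num))
    have hc := b.mem_coreLo_of_zone hκ h7 ⟨ht.1.le, h5⟩
    have ha := b.alphaLo_mem_of_zone hκ h7 ⟨ht.1.le, h5⟩
    have ha4 : b.alphaLo κ t < 4 := by
      have := (b.alphaLo_lt_iff' hκ h7 fifteen_quarters_mem hc).2 h; linarith
    have hθ : turnX (b.alphaLo κ t) ∈ Icc (-7 : ℝ) 4 := by
      have := turnX_mem_of_le ha4.le; exact ⟨by linarith [this.1, ha.1], this.2⟩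
    -- derivative of the inner clock
    have hin : HasDerivAt (fun t ↦ turnX (b.alphaLo κ t)) (deriv turnX (b.alphaLo κ t) * (deriv b.chiLo t / κ)) t :=
      ((contDiff_turnX.differentiable (by simp)) _).hasDerivAt.comp t (b.hasDerivAt_alphaLo κ t)
    have hin0 : deriv turnX (b.alphaLo κ t) * (deriv b.chiLo t / κ) ≠ 0 :=
      mul_ne_zero (deriv_turnX_pos ha4).ne' (div_pos (b.deriv_chiLo_pos hc) hκ).ne'
    have hout : HasDerivAt (b.chordPiece κ u) (deriv (b.chordPiece κ u) (turnX (b.alphaLo κ t))) (turnX (b.alphaLo κ t)) := by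
      have hsc : κ * (|turnX (b.alphaLo κ t)| + 1) < r := by
        have : |turnX (b.alphaLo κ t)| ≤ 7 := abs_le.2 ⟨hθ.1, by linarith [hθ.2]⟩; nlinarith
      have hq : ‖(pt2 (κ * turnX (b.alphaLo κ t)) (-κ) : 𝔼 2)‖ < b.poleRad hcross := (norm_railLoParam_lt hκ hsc).trans_le hf.r_le
      have h := (b.contDiffAt_chordPiece hcross (κ := κ) (u := u) hq).comp (turnX (b.alphaLo κ t)) ((contDiffAt_const (c := u)).prodMk contDiffAt_id)
      exact (h.differentiableAt (by simp)).hasDerivAt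
    have hcomp : HasDerivAt (fun t ↦ b.chordPiece κ u (turnX (b.alphaLo κ t)))
        ((deriv turnX (b.alphaLo κ t) * (deriv b.chiLo t / κ)) • deriv (b.chordPiece κ u) (turnX (b.alphaLo κ t))) t :=
      HasDerivAt.scomp (g₁ := b.chordPiece κ u) (h := fun t ↦ turnX (b.alphaLo κ t)) t hout hin
    rw [hcomp.deriv]
    exact smul_ne_zero hin0 (b.deriv_chordPiece_ne_zero hκ hf h9r hgood hε1 hu hθ)
  · -- band zone
    have h11 : b.parLo hκ h7 eleven_quarters_mem < t :=
      lt_of_lt_of_le (b.parLo_lt_parLo hκ h7 eleven_quarters_mem fifteen_quarters_mem (by norm_num)) h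
    have hev : b.arcChart hκ h7 h7' u =ᶠ[𝓝 t] fun t ↦ b.Fband (κ • b.deepTrack hκ h7 h7' t) := by
      filter_upwards [Ioo_mem_nhds h11 ht.2] with s hs using b.arcChart_eq_band hκ h7 h7' ⟨hs.1.le, hs.2.le⟩
    rw [hev.deriv_eq]
    have ht' : t ∈ Icc (b.parLo hκ h7 neg_seven_mem) (b.parHi hκ h7' neg_seven_mem) := ⟨ht.1.le, ht.2.le⟩
    have hq := b.norm_smul_deepTrack_lt_r hκ h7 h7' h9r ht'
    have hF := (b.differentiableAt_Fband hcross (hq.trans_le hf.r_le)).hasFDerivAt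
    have hin : HasDerivAt (fun t ↦ κ • b.deepTrack hκ h7 h7' t) (κ • deriv (b.deepTrack hκ h7 h7') t) t :=
      (((b.contDiff_deepTrack hκ h7 h7').differentiable (by simp)) t).hasDerivAt.const_smul κ
    have hcomp : HasDerivAt (fun t ↦ b.Fband (κ • b.deepTrack hκ h7 h7' t))
        (fderiv ℝ b.Fband (κ • b.deepTrack hκ h7 h7' t) (κ • deriv (b.deepTrack hκ h7 h7') t)) t :=
      HasFDerivAt.comp_hasDerivAt (l := b.Fband) (f := fun t ↦ κ • b.deepTrack hκ h7 h7' t) t hF hin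
    rw [hcomp.deriv]
    exact b.fderiv_Fband_ne_zero hf hε1 hq (smul_ne_zero hκ.ne' (b.deriv_deepTrack_ne_zero hκ h7 h7' ht'))

/-! ### Injectivity -/

omit h7 h7' in
/-- **The first blow-up coordinate of the chord piece is strictly increasing on `[-3, 4]`**
(`ε (6 + 8 B_c) ≤ 1/2`). [folklore] -/
theorem strictMonoOn_blowUp_chordPiece_zero' (hgood : ε * (6 + 8 * chordBumpBound) ≤ 1 / 2) {u : ℝ} (hu : u ∈ Icc (0 : ℝ) 1) :
    StrictMonoOn (fun a ↦ b.blowUp hcross κ (b.chordPiece κ u a) 0) (Icc (-3) 4) := by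
  have h4 : κ * 4 < r := by linarith
  have hB0 := chordBumpBound_spec.1
  have hε := hf.eps_nonneg
  have hε1 : ε ≤ 1 / 12 := by nlinarith
  have hder : ∀ a ∈ Icc (-3 : ℝ) 4, ∃ g', HasDerivAt (fun a ↦ b.blowUp hcross κ (b.chordPiece κ u a) 0) g' a ∧ 1 / 2 ≤ g' := by
    intro a ha
    by_cases h3 : |a| ≤ 3
    · obtain ⟨g', hg', hb⟩ := b.hasDerivAt_blowUp_chordPiece_zero hf hκ h4 hu (by nlinarith) h3
      exact ⟨g', hg', by linarith⟩
    · -- `a ∈ (3, 4]`: the chord piece is the rail near `a`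
      have ha3 : 3 < a := by
        by_contra hle; push Not at hle; exact h3 (abs_le.2 ⟨by linarith [ha.1], hle⟩)
      have hsc : κ * (|a| + 1) < r := by rw [abs_of_pos (by linarith)]; nlinarith [ha.2]
      obtain ⟨V, hV, hVb⟩ := b.hasDerivAt_blowUp_railLoPsi hf hκ hsc
      have hev : (fun a ↦ b.blowUp hcross κ (b.chordPiece κ u a) 0) =ᶠ[𝓝 a] fun a ↦ b.blowUp hcross κ (b.railLoPsi κ a) 0 := by
        filter_upwards [Ioi_mem_nhds (show (11 / 4 : ℝ) < a by linarith)] with x hx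
        rw [b.chordPiece_eq_rail (fun hm ↦ by linarith [hm.2, hx.out])]
      have hR : HasDerivAt (fun a ↦ b.blowUp hcross κ (b.railLoPsi κ a) 0) (V 0) a :=
        ((EuclideanSpace.proj (0 : Fin 3) : 𝔼 3 →L[ℝ] ℝ).hasFDerivAt).comp_hasDerivAt a hV
      refine ⟨V 0, hR.congr_of_eventuallyEq hev, ?_⟩
      have hVb0 : |V 0 - 1| ≤ ε := by
        have := (BandFoliation.abs_apply_le_norm (V - pt3 1 0 0) 0).trans hVb; simpa using this
      linarith [(abs_le.1 hVb0).1]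
  refine strictMonoOn_of_deriv_pos (convex_Icc _ _) (fun a ha ↦ ?_) (fun a ha ↦ ?_)
  · obtain ⟨g', hg', -⟩ := hder a ha
    exact hg'.continuousAt.continuousWithinAt
  · obtain ⟨g', hg', hb⟩ := hder a (interior_subset ha)
    rw [hg'.deriv]; linarith

omit h7 h7' in
/-- The chord piece is injective on `[-3, 4]`. [folklore] -/
theorem injOn_chordPiece' (hgood : ε * (6 + 8 * chordBumpBound) ≤ 1 / 2) {u : ℝ} (hu : u ∈ Icc (0 : ℝ) 1) :
    InjOn (b.chordPiece κ u) (Icc (-3) 4) := fun a ha a' ha' h ↦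
  (b.strictMonoOn_blowUp_chordPiece_zero' hκ hf h9r hgood hu).injOn ha ha' (by simp only [h])

omit h7 h7' h9r in
/-- **Injectivity of `Fband` on scaled planar parameters** (`‖κ q‖, ‖κ q'‖ < min r (1/2)`). [folklore] -/
theorem Fband_smul_injective {q q' : 𝔼 2} (hq : ‖κ • q‖ < r) (hq' : ‖κ • q'‖ < r) (hq2 : ‖κ • q‖ < 2⁻¹) (hq2' : ‖κ • q'‖ < 2⁻¹)
    (h : b.Fband (κ • q) = b.Fband (κ • q')) : q = q' := by
  have hs' := b.band_ne_northPole_of_norm_lt hcross (hq.trans_le hf.r_le)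
  have ht' := b.band_ne_northPole_of_norm_lt hcross (hq'.trans_le hf.r_le)
  have h1 : b.band (pt2 2⁻¹ 2⁻¹ + κ • q) = b.band (pt2 2⁻¹ 2⁻¹ + κ • q') := by
    have := congrArg psiN.symm h
    rwa [Fband, Fband, psiN_symm_apply_psiN hs', psiN_symm_apply_psiN ht'] at this
  have h2 := b.injOn (b.centre_add_mem_squareNhd hq2) (b.centre_add_mem_squareNhd hq2') h1
  exact smul_right_injective (𝔼 2) hκ.ne' (add_left_cancel h2)

/-- **The deep arc is injective on `[parLo (-3), parHi (-3)]`** (`u ∈ [0, 1]`, `ε (6 + 8 B_c) ≤ 1/2`,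
`ε ≤ 1/64`, `9κ < 1/2`). [folklore] -/
theorem injOn_arcChart (hgood : ε * (6 + 8 * chordBumpBound) ≤ 1 / 2) (hε64 : ε ≤ 1 / 64) (hκ2 : κ * 9 < 2⁻¹) {u : ℝ}
    (hu : u ∈ Icc (0 : ℝ) 1) :
    InjOn (b.arcChart hκ h7 h7' u) (Icc (b.parLo hκ h7 neg_three_mem) (b.parHi hκ h7' neg_three_mem)) := by
  have hε := hf.eps_nonneg
  have hlo3 : b.parLo hκ h7 neg_seven_mem ≤ b.parLo hκ h7 neg_three_mem := b.parLo_le_parLo hκ h7 neg_seven_mem neg_three_mem (by norm_num)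
  have hhi3 : b.parHi hκ h7' neg_three_mem ≤ b.parHi hκ h7' neg_seven_mem := b.parHi_le_parHi hκ h7' neg_seven_mem neg_three_mem (by norm_num)
  have h72_15 : b.parLo hκ h7 seven_halves_mem < b.parLo hκ h7 fifteen_quarters_mem := b.parLo_lt_parLo hκ h7 seven_halves_mem fifteen_quarters_mem (by norm_num)
  have h11_72 : b.parLo hκ h7 eleven_quarters_mem ≤ b.parLo hκ h7 seven_halves_mem := b.parLo_le_parLo hκ h7 eleven_quarters_mem seven_halves_mem (by norm_num)
  have h7_11 : b.parLo hκ h7 neg_seven_mem ≤ b.parLo hκ h7 eleven_quarters_mem := b.parLo_le_parLo hκ h7 neg_seven_mem eleven_quarters_mem (by norm_num)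
  have h15_5 : b.parLo hκ h7 fifteen_quarters_mem ≤ b.parLo hκ h7 five_mem := b.parLo_le_parLo hκ h7 fifteen_quarters_mem five_mem (by norm_num)
  -- injectivity on the chord zone `P`
  have hP : InjOn (b.arcChart hκ h7 h7' u) (Icc (b.parLo hκ h7 neg_three_mem) (b.parLo hκ h7 fifteen_quarters_mem)) := by
    intro s hs t ht hst
    rw [b.arcChart_eq_chordPiece_turnX hκ h7 h7' ⟨le_trans hlo3 hs.1, hs.2⟩, b.arcChart_eq_chordPiece_turnX hκ h7 h7' ⟨le_trans hlo3 ht.1, ht.2⟩] at hst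
    have hcs := b.mem_coreLo_of_zone hκ h7 ⟨le_trans hlo3 hs.1, le_trans hs.2 h15_5⟩
    have hct := b.mem_coreLo_of_zone hκ h7 ⟨le_trans hlo3 ht.1, le_trans ht.2 h15_5⟩
    have has : b.alphaLo κ s ∈ Icc (-3 : ℝ) (15 / 4) := ⟨(b.le_alphaLo_iff' hκ h7 neg_three_mem hcs).2 hs.1, (b.alphaLo_le_iff' hκ h7 fifteen_quarters_mem hcs).2 hs.2⟩
    have hat : b.alphaLo κ t ∈ Icc (-3 : ℝ) (15 / 4) := ⟨(b.le_alphaLo_iff' hκ h7 neg_three_mem hct).2 ht.1, (b.alphaLo_le_iff' hκ h7 fifteen_quarters_mem hct).2 ht.2⟩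
    have hθs : turnX (b.alphaLo κ s) ∈ Icc (-3 : ℝ) 4 := by
      have := turnX_mem_of_le (show b.alphaLo κ s ≤ 4 by linarith [has.2]); exact ⟨by linarith [this.1, has.1], this.2⟩
    have hθt : turnX (b.alphaLo κ t) ∈ Icc (-3 : ℝ) 4 := by
      have := turnX_mem_of_le (show b.alphaLo κ t ≤ 4 by linarith [hat.2]); exact ⟨by linarith [this.1, hat.1], this.2⟩
    have e1 := b.injOn_chordPiece' hκ hf h9r hgood hu hθs hθt hst
    have e2 : b.alphaLo κ s = b.alphaLo κ t :=
      strictMonoOn_turnX.injOn (show b.alphaLo κ s ∈ Iic (4 : ℝ) by simp only [mem_Iic]; linarith [has.2])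
        (show b.alphaLo κ t ∈ Iic (4 : ℝ) by simp only [mem_Iic]; linarith [hat.2]) e1
    exact (b.strictMonoOn_alphaLo (κ := κ) hκ).injOn hcs hct e2
  -- injectivity on the band zone `Q`
  have hQ : InjOn (b.arcChart hκ h7 h7' u) (Icc (b.parLo hκ h7 seven_halves_mem) (b.parHi hκ h7' neg_three_mem)) := by
    intro s hs t ht hst
    have hs' : s ∈ Icc (b.parLo hκ h7 neg_seven_mem) (b.parHi hκ h7' neg_seven_mem) := ⟨by linarith [hs.1, h11_72, h7_11], le_trans hs.2 hhi3⟩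
    have ht' : t ∈ Icc (b.parLo hκ h7 neg_seven_mem) (b.parHi hκ h7' neg_seven_mem) := ⟨by linarith [ht.1, h11_72, h7_11], le_trans ht.2 hhi3⟩
    rw [b.arcChart_eq_band hκ h7 h7' ⟨le_trans h11_72 hs.1, le_trans hs.2 hhi3⟩, b.arcChart_eq_band hκ h7 h7' ⟨le_trans h11_72 ht.1, le_trans ht.2 hhi3⟩] at hst
    have hn := fun (x : ℝ) (hx : x ∈ Icc (b.parLo hκ h7 neg_seven_mem) (b.parHi hκ h7' neg_seven_mem)) ↦ b.norm_deepTrack_le hκ h7 h7' hx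
    have hq2 : ∀ x ∈ Icc (b.parLo hκ h7 neg_seven_mem) (b.parHi hκ h7' neg_seven_mem), ‖κ • b.deepTrack hκ h7 h7' x‖ < 2⁻¹ := fun x hx ↦ by
      rw [norm_smul, Real.norm_eq_abs, abs_of_pos hκ]; have := hn x hx; nlinarith
    have e := b.Fband_smul_injective hκ hf (b.norm_smul_deepTrack_lt_r hκ h7 h7' h9r hs') (b.norm_smul_deepTrack_lt_r hκ h7 h7' h9r ht')
      (hq2 s hs') (hq2 t ht') hst
    exact b.injOn_deepTrack hκ h7 h7' hs' ht' e
  -- the two zones: separation of `P \ Q` from `Q \ P` by the blow-up coordinates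
  intro s hs t ht hst
  by_contra hne
  wlog hlt : s < t generalizing s t
  · exact this ht hs hst.symm (Ne.symm hne) (lt_of_le_of_ne (not_lt.1 hlt) (Ne.symm hne))
  rcases le_or_gt t (b.parLo hκ h7 fifteen_quarters_mem) with ht1 | ht1
  · exact hne (hP ⟨hs.1, by linarith⟩ ⟨ht.1, ht1⟩ hst)
  rcases le_or_gt (b.parLo hκ h7 seven_halves_mem) s with hs1 | hs1
  · exact hne (hQ ⟨hs1, hs.2⟩ ⟨by linarith, ht.2⟩ hst)
  -- `s < parLo (7/2)` and `t > parLo (15/4)`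
  have hY := congrArg (b.blowUp hcross κ) hst
  have hsc := b.norm_blowUp_arcChart_sub_le_chord hκ h7 h7' hf h9r hu ⟨le_trans hlo3 hs.1, by linarith⟩
  have htb := b.norm_blowUp_arcChart_sub_le_band hκ h7 h7' hf h9r (u := u) ⟨by linarith [h11_72], le_trans ht.2 hhi3⟩
  have hcs := b.mem_coreLo_of_zone hκ h7 ⟨le_trans hlo3 hs.1, by linarith⟩
  have hθs : turnX (b.alphaLo κ s) = b.alphaLo κ s := turnX_of_le ((b.alphaLo_lt_iff' hκ h7 seven_halves_mem hcs).2 hs1).le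
  have has72 : b.alphaLo κ s < 7 / 2 := (b.alphaLo_lt_iff' hκ h7 seven_halves_mem hcs).2 hs1
  -- coordinates of the `s`-point
  have hs0 := (BandFoliation.abs_apply_le_norm _ 0).trans hsc
  have hs1' := (BandFoliation.abs_apply_le_norm _ 1).trans hsc
  rw [sub_pt3_apply_zero, hθs] at hs0
  rw [sub_pt3_apply_one] at hs1'
  -- coordinates of the `t`-point
  have ht0 := (BandFoliation.abs_apply_le_norm _ 0).trans htb
  have ht1' := (BandFoliation.abs_apply_le_norm _ 1).trans htb
  rw [sub_pt3_apply_zero] at ht0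
  rw [sub_pt3_apply_one] at ht1'
  rw [hY] at hs0 hs1'
  rcases le_or_gt t (b.parLo hκ h7 five_mem) with ht2 | ht2
  · -- lower band zone beyond `15/4`: first coordinates differ
    have hct := b.mem_coreLo_of_zone hκ h7 ⟨by linarith [hlo3, ht.1], ht2⟩
    have hat : 15 / 4 < b.alphaLo κ t := (b.lt_alphaLo_iff' hκ h7 fifteen_quarters_mem hct).2 ht1
    have hX : 15 / 4 < b.deepTrack hκ h7 h7' t 0 := by
      rw [b.deepTrack_of_le hκ h7 h7' ht2, lowerTurn_apply_zero]
      rcases le_or_gt (b.alphaLo κ t) 4 with h4 | h4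
      · linarith [(turnX_mem_of_le h4).1]
      · linarith [(turnX_le_of_ge h4.le).1]
    have a1 := (abs_le.1 hs0).2
    have a2 := (abs_le.1 ht0).1
    linarith
  · -- tip or upper zone: second coordinates differ
    have hV : -(3 / 8) ≤ b.deepTrack hκ h7 h7' t 1 := by
      rcases le_or_gt t (b.parHi hκ h7' five_mem) with ht3 | ht3
      · exact (b.deepTrack_one_mem_of_mem hκ h7 h7' ⟨ht2.le, ht3⟩).1
      · linarith [b.le_deepTrack_one_of_ge hκ h7 h7' ⟨ht3.le, le_trans ht.2 hhi3⟩]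
    have a1 := (abs_le.1 hs1').2
    have a2 := (abs_le.1 ht1').1
    linarith

end Flat

/-! ### The deep arc on the sphere -/

/-- **The deep arc on the sphere**, as a point of `ℝ⁴`: `ψ⁻¹ (arcChart u t)`. [folklore] -/
def arcPiece (u t : ℝ) : 𝔼 4 := ((psiN.symm (b.arcChart hκ h7 h7' u t) : 𝕊 3) : 𝔼 4)

/-- The deep arc on the sphere is a unit vector. [folklore] -/
theorem norm_arcPiece (u t : ℝ) : ‖b.arcPiece hκ h7 h7' u t‖ = 1 := by
  rw [arcPiece]; exact norm_eq_of_mem_sphere _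

/-- The deep arc on the sphere is jointly `C^∞` (interior parameters, `9κ ≤ poleRad`). [folklore] -/
theorem contDiffAt_arcPiece (h9 : κ * 9 ≤ b.poleRad hcross) {u t : ℝ}
    (ht : t ∈ Ioo (b.parLo hκ h7 neg_seven_mem) (b.parHi hκ h7' neg_seven_mem)) :
    ContDiffAt ℝ ∞ (uncurry (b.arcPiece hκ h7 h7')) (u, t) :=
  contDiff_coe_psiN_symm.contDiffAt.comp (u, t) (b.contDiffAt_arcChart hcross hκ h7 h7' h9 ht)

/-- The deep arc on the sphere is injective where the chart arc is. [folklore] -/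
theorem injOn_arcPiece_of {u : ℝ} {S : Set ℝ} (h : InjOn (b.arcChart hκ h7 h7' u) S) : InjOn (b.arcPiece hκ h7 h7' u) S :=
  fun _ hs _ ht hst ↦ h hs ht (coe_psiN_symm_injective hst)

/-- The deep arc on the sphere is regular where the chart arc is (`9κ ≤ poleRad`). [folklore] -/
theorem deriv_arcPiece_ne_zero_of (h9 : κ * 9 ≤ b.poleRad hcross) {u t : ℝ}
    (ht : t ∈ Ioo (b.parLo hκ h7 neg_seven_mem) (b.parHi hκ h7' neg_seven_mem)) (h : deriv (b.arcChart hκ h7 h7' u) t ≠ 0) :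
    deriv (b.arcPiece hκ h7 h7' u) t ≠ 0 := by
  have hd : HasDerivAt (b.arcChart hκ h7 h7' u) (deriv (b.arcChart hκ h7 h7' u) t) t :=
    ((b.contDiffAt_arcChart_right hcross hκ h7 h7' h9 u ht).differentiableAt (by simp)).hasDerivAt
  exact deriv_coe_psiN_symm_comp_ne_zero hd h

end BandData

end Literature.Topology.FourManifolds
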